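import Summits.Ventures.CertifiedManyBodySolver.Theorems.M3x2EdgeSplitSymReplayOutRouteL
import Std.Data.HashMap.Lemmas
import Mathlib.Data.Multiset.Bind
import HarnessLib

/-!
# SymReplay gramR — OUTROUTE (T20c): the MOMENT-BUCKETED enumerator `shareRFastM` (engine E3) and its permutation lemma

Output routing (`…OutRoute`, `…OutRouteL`) is sound for ANY key `κ : Word → ℕ`, but its executed share `shareR K κ J i`
VISITS every raw R-product `u† ++ w` of the certificate in every module (2–6 · 10⁹ at E-class) — measured ≈ 45 µs per term
for `pairKey` under the farm's evaluator (hub-lb-sym-eng-3 g2, STATUS «OUTROUTE SKELETON RATES»): dead at E-class.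
This module cuts the VISITS instead of their price.  The key is read off the per-spin MOMENT VECTOR
`mom S w` of an ADDITIVE letter valuation `S : MomSpec M` (v0′/E-class: `M = ℤ⁶`, `(Q↑, Q↓, D↑, D↓)` with
`D_σ = Σ_{ℓ of spin σ} (±1) · x_ℓ`, `…OutRouteM2.momSpec6`; a finer table = a richer `M`, no new lemma), additive over
concatenation (`mom_append`) — so for a representative term `u†` with moment `μ` the in-slot partners `w` are exactly those with
`mom w = m − μ` for a TARGET moment `m` of the module, found by hash LOOKUP in a per-block bucket map of the generated
basis terms (`bucketOf`), never by scanning.  The module index of a moment is a shipped table `hm : MomTable M`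
(built ONLY by `momTable entries`)
(`momKey S hm w := hm.getD (mom S w) 0`; the producer gives all affine-`D₄` images of a class the same index — completeness is
its business, soundness needs nothing); `targetsM hm J i` = the table keys of index `≡ i (mod J)`.

SOUNDNESS = ONE permutation lemma against the landed spec (T20b §(h)):
`shareRFastM_perm : coverM S K gbs hm = true → (shareRFastM S K gbs hm J i).Perm (shareR K (momKey S hm) J i)` at
`gbs = K.gramR.map genBasis`, where the cheap global side fact `coverM` («every occurring product moment is IN the table»,
one lookup per (representative term, distinct basis moment)) makes the table's default branch vacuous; then
`energyDensity_ge_of_outrouteM` is `energyDensity_ge_of_outrouteSB` instantiated.  Per-module cost = bucket maps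
(Σ basis terms) + |rep terms| · |targets_i| lookups + the in-slot candidates (≈ 1/J of the raw terms) — no O(pairs) pass.

CONTENTS: (j) `MomSpec`, `mom`, `mom_append`, `productMoms`, `MomTable`/`momTable`, `momKey`;
(k) `wflat`, `bucketOf` + `bucketOf_getD` / `mem_bucketOf_iff`,
`targetsM` + `mem_targetsM_iff` / `targetsM_nodup`, `shareRWithM`, `shareRFastM`, `coverM`; (l) list algebra
(`flatMap_comm_perm`, `flatMap_filter_eq_perm`), the block lemma and `shareRFastM_perm`; (m) closing
`energyDensity_ge_of_outrouteM`.  The `ℤ⁶` valuation of record `momSpec6`, its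
point-group images and the end-to-end toy are in `…OutRouteM2`.
CLOSING GRAMMAR (literals `S hm J lo hi`, `gbs := K.gramR.map genBasis`): `hcov : coverM S K gbs hm = true := by
native_decide` (once); per module `i < J`: `out_i : isZero (canonNFZB lo hi (shareRFastM S K gbs hm J i)) = true := by
native_decide`; close `energyDensity_ge_of_outrouteM S K hwf hRok hm J hJ lo hi hbox hcov ⟨out_0, …, out_{J−1}, trivial⟩`.

HONEST FRAMING: checker plumbing (an enumerator and its permutation lemma); no certificate is replayed here; no bound of
record moves; no summit or crux statement is proved; nothing here predicts superconductivity.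
-/

namespace Summit.Ventures.CertifiedManyBodySolver.Theorems.SymReplay

open Literature.MathematicalPhysics.QuantumLattice.ThermodynamicLimit

/-! ##### (j) Additive letter valuations and word moments -/

/-- **An additive moment valuation of letters** in a key type `M`: the letter map and the three list-algebra laws the
enumerator's permutation lemma needs (nothing else about `M` is used; soundness holds for ANY valuation and ANY table). -/
structure MomSpec (M : Type) where
  /-- moment of one letter -/
  φ : Letter → M
  /-- sum of moments -/
  add : M → M → M
  /-- difference of moments (bucket lookup key `target − μ`) -/
  sub : M → M → M
  /-- moment of the empty word -/
  zero : M
  /-- associativity -/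
  add_assoc : ∀ a b c, add (add a b) c = add a (add b c)
  /-- left unit -/
  zero_add : ∀ a, add zero a = a
  /-- `c = a − b ↔ b + c = a` -/
  eq_sub_iff_add_eq : ∀ a b c, c = sub a b ↔ add b c = a

variable {M : Type}

/-- **Moment of a word** (letter-additive). -/
def mom (S : MomSpec M) : Word → M
  | [] => S.zero
  | ℓ :: w => S.add (S.φ ℓ) (mom S w)

/-- **Additivity over concatenation** — the whole engine rests on this. -/
theorem mom_append (S : MomSpec M) (u w : Word) : mom S (u ++ w) = S.add (mom S u) (mom S w) := by
  induction u with
  | nil => exact (S.zero_add _).symm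
  | cons ℓ u ih => rw [List.cons_append, mom, mom, ih, S.add_assoc]

/-! ##### (k) The moment-bucketed enumerator -/

/-- A block's generated basis terms, flat, each tagged with its factor row: `(L_j, (c, w))`. -/
def wflat (qr : List (QPoly × List (ℚ × ℕ))) : List (List (ℚ × ℕ) × (ℚ × Word)) :=
  qr.flatMap fun b => b.1.map fun t' => (b.2, t')

/-- All occurring R-product moments of a certificate (producer-side helper). -/
def productMoms (S : MomSpec M) (K : SymCertR) (gbs : List (List QPoly)) : List M :=
  (K.gramR.zip gbs).flatMap fun Bg =>
    (Bg.1.reps.zip Bg.1.rows).flatMap fun a =>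
      (padj a.1).flatMap fun t => (wflat (Bg.2.zip Bg.1.rows)).map fun x => S.add (mom S t.2) (mom S x.2.2)

/-! ##### Tables (the `BEq` of every table is the one decidable equality induces — build tables ONLY with `momTable`) -/

variable [DecidableEq M] [Hashable M]

/-- **The type of moment tables** `moment ↦ module index` (fixes the `BEq`/`Hashable` instances the engine uses). -/
abbrev MomTable (M : Type) [DecidableEq M] [Hashable M] : Type := Std.HashMap M ℕ

/-- **Table constructor for producers / certificate modules** (later entries win on duplicate keys). -/
def momTable (entries : List (M × ℕ)) : MomTable M := Std.HashMap.ofList entries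

/-- **The moment-table key**: the module index the table assigns to the word's moment (`0` off the table).  Sound for
ANY table (T20a); complete when the producer indexes by affine-`D₄` class of the canonical word. -/
def momKey (S : MomSpec M) (hm : MomTable M) (w : Word) : ℕ := hm.getD (mom S w) 0

/-- **Bucket map** of tagged terms by moment (later terms first within a bucket). -/
def bucketOf (S : MomSpec M) (xs : List (List (ℚ × ℕ) × (ℚ × Word))) :
    Std.HashMap M (List (List (ℚ × ℕ) × (ℚ × Word))) :=
  xs.foldl (fun mp x => mp.insert (mom S x.2.2) (x :: mp.getD (mom S x.2.2) [])) ∅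

/-- The fold behind `bucketOf`, from an arbitrary start map (for the invariant proofs). -/
theorem bucketOf_foldl_getD (S : MomSpec M) (xs : List (List (ℚ × ℕ) × (ℚ × Word))) :
    ∀ (mp : Std.HashMap M (List (List (ℚ × ℕ) × (ℚ × Word)))) (pre : List (List (ℚ × ℕ) × (ℚ × Word))),
      (∀ m, mp.getD m [] = (pre.filter fun x => decide (mom S x.2.2 = m)).reverse) →
      ∀ m, (xs.foldl (fun mp x => mp.insert (mom S x.2.2) (x :: mp.getD (mom S x.2.2) [])) mp).getD m [] =
        ((pre ++ xs).filter fun x => decide (mom S x.2.2 = m)).reverse := by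
  induction xs with
  | nil => intro mp pre h m; rw [List.foldl_nil, List.append_nil]; exact h m
  | cons x xs ih =>
    intro mp pre h m
    rw [List.foldl_cons, show pre ++ x :: xs = pre ++ [x] ++ xs by simp]
    refine ih _ (pre ++ [x]) (fun m' => ?_) m
    rw [Std.HashMap.getD_insert, List.filter_append, List.reverse_append]
    by_cases hx : mom S x.2.2 = m'
    · subst hx
      simp [h]
    · simp [h, hx]

/-- **Bucket `m` = the terms of moment `m`** (reversed). -/
theorem bucketOf_getD (S : MomSpec M) (xs : List (List (ℚ × ℕ) × (ℚ × Word))) (m : M) :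
    (bucketOf S xs).getD m [] = (xs.filter fun x => decide (mom S x.2.2 = m)).reverse := by
  have h := bucketOf_foldl_getD S xs ∅ [] (fun m => by simp) m
  rwa [List.nil_append] at h

/-- Membership in the fold behind `bucketOf`. -/
theorem bucketOf_foldl_mem (S : MomSpec M) (xs : List (List (ℚ × ℕ) × (ℚ × Word))) :
    ∀ (mp : Std.HashMap M (List (List (ℚ × ℕ) × (ℚ × Word)))) (m : M),
      m ∈ xs.foldl (fun mp x => mp.insert (mom S x.2.2) (x :: mp.getD (mom S x.2.2) [])) mp ↔
        m ∈ mp ∨ ∃ x ∈ xs, mom S x.2.2 = m := by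
  induction xs with
  | nil => intro mp m; simp
  | cons x xs ih =>
    intro mp m
    rw [List.foldl_cons, ih, Std.HashMap.mem_insert]
    constructor
    · rintro ((h | h) | ⟨y, hy, h⟩)
      · exact Or.inr ⟨x, List.mem_cons_self, by simpa using h⟩
      · exact Or.inl h
      · exact Or.inr ⟨y, List.mem_cons_of_mem _ hy, h⟩
    · rintro (h | ⟨y, hy, h⟩)
      · exact Or.inl (Or.inr h)
      · rw [List.mem_cons] at hy
        rcases hy with rfl | hy
        · exact Or.inl (Or.inl (by simpa using h))
        · exact Or.inr ⟨y, hy, h⟩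

/-- **The bucket map's keys are the occurring moments.** -/
theorem mem_bucketOf_iff (S : MomSpec M) (xs : List (List (ℚ × ℕ) × (ℚ × Word))) (m : M) :
    m ∈ bucketOf S xs ↔ ∃ x ∈ xs, mom S x.2.2 = m := by
  rw [bucketOf, bucketOf_foldl_mem S]; simp

/-- **Target moments of module `i`**: the table's moments whose index is `≡ i (mod J)`. -/
def targetsM (hm : MomTable M) (J i : ℕ) : List M :=
  hm.keys.filter fun m => hm.getD m 0 % J == i

/-- Targets = table moments of index `i (mod J)`. -/
theorem mem_targetsM_iff (hm : MomTable M) (J i : ℕ) (m : M) :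
    m ∈ targetsM hm J i ↔ m ∈ hm ∧ hm.getD m 0 % J = i := by
  rw [targetsM, List.mem_filter, Std.HashMap.mem_keys, beq_iff_eq]

/-- Targets are distinct. -/
theorem targetsM_nodup (hm : MomTable M) (J i : ℕ) : (targetsM hm J i).Nodup :=
  Std.HashMap.nodup_keys.filter _

/-- **One representative row of the moment-bucketed enumeration** (`wmap` = the block's bucket map, `m` = `|moves|`,
`s` = the block scale, `T` = the module's targets): per representative term `(c, u†)` with moment `μ` and target `mt`,
the bucket of `mt − μ`, row pairs with `⟨L_i, L_j⟩ = 0` dropped, coefficient and word exactly as in `shareR`. -/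
def rowFast (S : MomSpec M) (a : QPoly × List (ℚ × ℕ)) (wmap : Std.HashMap M (List (List (ℚ × ℕ) × (ℚ × Word))))
    (m s : ℚ) (T : List M) : QPoly :=
  (padj a.1).flatMap fun t =>
    T.flatMap fun mt =>
      (wmap.getD (S.sub mt (mom S t.2)) []).filterMap fun x =>
        if sdot a.2 x.1 = 0 then none
        else some (-1 * (m * (s * sdot a.2 x.1)) * (t.1 * x.2.1), t.2 ++ x.2.2)

/-- **The R-part of module `i`'s share, enumerated by LOOKUP** (generated bases `gbs` supplied; ONE bucket map per block). -/
def shareRWithM (S : MomSpec M) (K : SymCertR) (gbs : List (List QPoly)) (T : List M) : QPoly :=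
  (K.gramR.zip gbs).flatMap fun Bg =>
    let wmap := bucketOf S (wflat (Bg.2.zip Bg.1.rows))
    (Bg.1.reps.zip Bg.1.rows).flatMap fun a => rowFast S a wmap Bg.1.moves.length Bg.1.scale T

/-- **Module `i`'s share, moment-bucketed** (`shareRF`'s pushed base part and gramM part, filtered directly — small). -/
def shareRFastM (S : MomSpec M) (K : SymCertR) (gbs : List (List QPoly)) (hm : MomTable M) (J i : ℕ) : QPoly :=
  let P := wordPred (inSlotW (momKey S hm) J i)
  baseShareF K.toSymCert P ++
  (pscale (-1) (K.gramM.flatMap fun B => (gramBlockPoly B).filter P) ++ shareRWithM S K gbs (targetsM hm J i))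

/-- **Coverage**: every product moment `mom u† + mom w` that occurs (representative term × DISTINCT basis moment, per
block) is a key of the table — so `momKey`'s default branch is never taken on the R-part. One cheap global fact. -/
def coverM (S : MomSpec M) (K : SymCertR) (gbs : List (List QPoly)) (hm : MomTable M) : Bool :=
  (K.gramR.zip gbs).all fun Bg =>
    let ks := (bucketOf S (wflat (Bg.2.zip Bg.1.rows))).keys
    (Bg.1.reps.zip Bg.1.rows).all fun a =>
      (padj a.1).all fun t => ks.all fun mw => hm.contains (S.add (mom S t.2) mw)

/-! ##### (l) List algebra and the permutation lemma -/

/-- Swapping two independent enumerations is a permutation. -/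
theorem flatMap_comm_perm {α β γ : Type} (l₁ : List α) (l₂ : List β) (f : α → β → List γ) :
    (l₁.flatMap fun a => l₂.flatMap fun b => f a b).Perm (l₂.flatMap fun b => l₁.flatMap fun a => f a b) := by
  rw [← Multiset.coe_eq_coe]
  simp only [← Multiset.coe_bind]
  exact Multiset.bind_bind _ _

/-- **Grouping by value is a permutation of filtering by membership** (distinct values). -/
theorem flatMap_filter_eq_perm {α μ : Type} [DecidableEq μ] (f : α → μ) (W : List α) :
    ∀ (C : List μ), C.Nodup →
      (C.flatMap fun c => W.filter fun x => decide (f x = c)).Perm (W.filter fun x => decide (f x ∈ C))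
  | [], _ => by simp
  | c :: C, hn => by
    rw [List.nodup_cons] at hn
    rw [List.flatMap_cons]
    refine ((flatMap_filter_eq_perm f W C hn.2).append_left _).trans ?_
    have h1 : (W.filter fun x => decide (f x ∈ c :: C)).filter (fun x => decide (f x = c)) =
        W.filter fun x => decide (f x = c) := by
      rw [List.filter_filter]
      refine List.filter_congr fun x _ => ?_
      by_cases h : f x = c <;> simp [h]
    have h2 : (W.filter fun x => decide (f x ∈ c :: C)).filter (fun x => !decide (f x = c)) =
        W.filter fun x => decide (f x ∈ C) := by
      rw [List.filter_filter]
      refine List.filter_congr fun x _ => ?_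
      by_cases h : f x = c
      · simp [h, hn.1]
      · simp [h]
    have h3 := List.filter_append_perm (fun x => decide (f x = c)) (W.filter fun x => decide (f x ∈ c :: C))
    rw [h1, h2] at h3
    exact h3

/-- The spec's R-part body for one representative row (the `qr.flatMap` inside `shareRWith`). -/
def rowSpec (a : QPoly × List (ℚ × ℕ)) (qr : List (QPoly × List (ℚ × ℕ))) (m s : ℚ) (P : ℚ × Word → Bool) : QPoly :=
  qr.flatMap fun b =>
    if sdot a.2 b.2 = 0 then [] else pscale (-1 * (m * (s * sdot a.2 b.2))) ((pmul (padj a.1) b.1).filter P)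

/-- `shareRWith` in terms of `rowSpec`. -/
theorem shareRWith_eq_rowSpec (K : SymCertR) (gbs : List (List QPoly)) (P : ℚ × Word → Bool) :
    shareRWith K gbs P = (K.gramR.zip gbs).flatMap fun Bg =>
      (Bg.1.reps.zip Bg.1.rows).flatMap fun a => rowSpec a (Bg.2.zip Bg.1.rows) Bg.1.moves.length Bg.1.scale P :=
  rfl

/-- The option-valued step both enumerations end in, on a tagged basis term `x = (L_j, (c', w))`. -/
def stepOpt (a : QPoly × List (ℚ × ℕ)) (m s : ℚ) (t : ℚ × Word) (x : List (ℚ × ℕ) × (ℚ × Word)) :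
    Option (ℚ × Word) :=
  if sdot a.2 x.1 = 0 then none else some (-1 * (m * (s * sdot a.2 x.1)) * (t.1 * x.2.1), t.2 ++ x.2.2)

/-- `pscale` of a filtered product row as a `filterMap`. -/
theorem pscale_filter_map_eq (q : ℚ) (P : ℚ × Word → Bool) (t : ℚ × Word) :
    ∀ (l : QPoly), pscale q ((l.map fun t' => (t.1 * t'.1, t.2 ++ t'.2)).filter P) =
      l.filterMap fun t' => if P (t.1 * t'.1, t.2 ++ t'.2) then some (q * (t.1 * t'.1), t.2 ++ t'.2) else none
  | [] => rfl
  | t' :: l => by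
    rw [List.map_cons, List.filter_cons, List.filterMap_cons]
    by_cases h : P (t.1 * t'.1, t.2 ++ t'.2) = true
    · rw [if_pos h, if_pos h, pscale, List.map_cons, ← pscale, pscale_filter_map_eq q P t l]
    · rw [if_neg h, if_neg h, pscale_filter_map_eq q P t l]

/-- **Spec row in flat form**: a `filterMap` over the flat tagged terms, representative terms outermost (a permutation). -/
theorem rowSpec_perm_flat (a : QPoly × List (ℚ × ℕ)) (qr : List (QPoly × List (ℚ × ℕ))) (m s : ℚ)
    (P : ℚ × Word → Bool) :
    (rowSpec a qr m s P).Perm ((padj a.1).flatMap fun t => (wflat qr).filterMap fun x =>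
      if P (t.1 * x.2.1, t.2 ++ x.2.2) then stepOpt a m s t x else none) := by
  -- (1) each block row `b` as a flatMap over the representative terms (list equality)
  have e1 : rowSpec a qr m s P = qr.flatMap fun b => (padj a.1).flatMap fun t => b.1.filterMap fun t' =>
      if P (t.1 * t'.1, t.2 ++ t'.2) then stepOpt a m s t (b.2, t') else none := by
    rw [rowSpec]
    refine List.flatMap_congr fun b _ => ?_
    by_cases hg : sdot a.2 b.2 = 0
    · rw [if_pos hg]
      symm
      rw [List.flatMap_eq_nil_iff]
      intro t _
      rw [List.filterMap_eq_nil_iff]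
      intro t' _
      simp [stepOpt, hg]
    · rw [if_neg hg, pmul, List.filter_flatMap, pscale_flatMap]
      refine List.flatMap_congr fun t _ => ?_
      rw [pscale_filter_map_eq]
      refine List.filterMap_congr fun t' _ => ?_
      simp [stepOpt, hg]
  rw [e1]
  -- (2) swap the two outer enumerations, (3) flatten the block rows
  refine (flatMap_comm_perm qr (padj a.1) _).trans (List.Perm.of_eq ?_)
  refine List.flatMap_congr fun t _ => ?_
  rw [wflat, List.filterMap_flatMap]
  refine List.flatMap_congr fun b _ => ?_
  rw [List.filterMap_map]
  rfl

/-- **Fast row vs flat spec row**: with the block's bucket map and the module's targets, `rowFast` is a permutation of the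
flat spec row keyed by `momKey S hm` — given coverage of the row's product moments. -/
theorem rowFast_perm (S : MomSpec M) (a : QPoly × List (ℚ × ℕ)) (qr : List (QPoly × List (ℚ × ℕ))) (m s : ℚ)
    (hm : MomTable M) (J i : ℕ)
    (hcov : ∀ t ∈ padj a.1, ∀ x ∈ wflat qr, S.add (mom S t.2) (mom S x.2.2) ∈ hm) :
    (rowFast S a (bucketOf S (wflat qr)) m s (targetsM hm J i)).Perm
      (rowSpec a qr m s (wordPred (inSlotW (momKey S hm) J i))) := by
  refine List.Perm.trans ?_ (rowSpec_perm_flat a qr m s _).symm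
  rw [rowFast]
  refine List.Perm.flatMap_left _ fun t ht => ?_
  -- buckets are the filtered flat list (reversed)
  have eb : ∀ mt : M, ((bucketOf S (wflat qr)).getD (S.sub mt (mom S t.2)) []).Perm
      ((wflat qr).filter fun x => decide (S.add (mom S t.2) (mom S x.2.2) = mt)) := by
    intro mt
    rw [bucketOf_getD]
    refine (List.reverse_perm _).trans (List.Perm.of_eq (List.filter_congr fun x _ => ?_))
    rw [decide_eq_decide, S.eq_sub_iff_add_eq]
  refine (List.Perm.flatMap_left _ fun mt _ => (eb mt).filterMap _).trans ?_
  rw [← List.filterMap_flatMap]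
  refine ((flatMap_filter_eq_perm (fun x => S.add (mom S t.2) (mom S x.2.2)) (wflat qr) _
    (targetsM_nodup hm J i)).filterMap _).trans (List.Perm.of_eq ?_)
  rw [List.filterMap_filter]
  refine List.filterMap_congr fun x hx => ?_
  -- pointwise: in-slot test of the spec = target membership (coverage makes the table total here)
  have hmem : S.add (mom S t.2) (mom S x.2.2) ∈ hm := hcov t ht x hx
  have hP : wordPred (inSlotW (momKey S hm) J i) (t.1 * x.2.1, t.2 ++ x.2.2) =
      decide (S.add (mom S t.2) (mom S x.2.2) ∈ targetsM hm J i) := by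
    rw [wordPred, inSlotW, slotOf, momKey, mom_append]
    by_cases h : hm.getD (S.add (mom S t.2) (mom S x.2.2)) 0 % J = i
    · rw [decide_eq_true ((mem_targetsM_iff hm J i _).2 ⟨hmem, h⟩)]; simpa using h
    · rw [decide_eq_false (fun hh => h ((mem_targetsM_iff hm J i _).1 hh).2)]; simpa using h
  rw [hP]
  by_cases h : S.add (mom S t.2) (mom S x.2.2) ∈ targetsM hm J i <;> simp [h, stepOpt]

/-- Coverage, unpacked for one block and row. -/
theorem coverM_row (S : MomSpec M) {K : SymCertR} {gbs : List (List QPoly)} {hm : MomTable M}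
    (h : coverM S K gbs hm = true)
    {Bg : GramBlockR × List QPoly} (hBg : Bg ∈ K.gramR.zip gbs) {a : QPoly × List (ℚ × ℕ)}
    (ha : a ∈ Bg.1.reps.zip Bg.1.rows) :
    ∀ t ∈ padj a.1, ∀ x ∈ wflat (Bg.2.zip Bg.1.rows), S.add (mom S t.2) (mom S x.2.2) ∈ hm := by
  intro t ht x hx
  rw [coverM, List.all_eq_true] at h
  have h1 := h Bg hBg
  simp only [List.all_eq_true] at h1
  have h2 := h1 a ha t ht (mom S x.2.2) (Std.HashMap.mem_keys.2 ((mem_bucketOf_iff S _ _).2 ⟨x, hx, rfl⟩))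
  exact Std.HashMap.mem_iff_contains.2 h2

/-- **THE PERMUTATION LEMMA (R-part)**: the moment-bucketed R-part is a permutation of `shareRWith` keyed by `momKey S hm`. -/
theorem shareRWithM_perm (S : MomSpec M) (K : SymCertR) (gbs : List (List QPoly)) (hm : MomTable M) (J i : ℕ)
    (hcov : coverM S K gbs hm = true) :
    (shareRWithM S K gbs (targetsM hm J i)).Perm (shareRWith K gbs (wordPred (inSlotW (momKey S hm) J i))) := by
  rw [shareRWith_eq_rowSpec, shareRWithM]
  refine List.Perm.flatMap_left _ fun Bg hBg => ?_
  exact List.Perm.flatMap_left _ fun a ha => rowFast_perm S a _ _ _ hm J i (coverM_row S hcov hBg ha)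

/-- **THE PERMUTATION LEMMA**: at the generated bases, module `i`'s moment-bucketed share is a permutation of
`shareR K (momKey S hm) J i` (T20b §(h) hypothesis `hS`). -/
theorem shareRFastM_perm (S : MomSpec M) (K : SymCertR) (hm : MomTable M) (J i : ℕ)
    (hcov : coverM S K (K.gramR.map genBasis) hm = true) :
    (shareRFastM S K (K.gramR.map genBasis) hm J i).Perm (shareR K (momKey S hm) J i) := by
  rw [← shareRF_eq, shareRFastM, shareRF]
  exact (List.Perm.append_left _ ((shareRWithM_perm S K _ hm J i hcov).append_left _))

/-! ##### (m) Closing theorem -/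

/-- **OUTROUTE with the moment-bucketed enumerator is sound.**  CLOSING GRAMMAR: `gbs := K.gramR.map genBasis` (a `def`
in the certificate's Defs module); `hcov : coverM S K gbs hm = true := by native_decide` (once); per module `i < J`
`out_i : isZero (canonNFZB lo hi (shareRFastM S K gbs hm J i)) = true := by native_decide`;
`hfacts := ⟨out_0, …, out_{J−1}, trivial⟩`. -/
theorem energyDensity_ge_of_outrouteM (S : MomSpec M) (K : SymCertR) (hwf : wellFormed K.expand = true)
    (hRok : K.gramR.all (gramBlockROK K.frame) = true) (hm : MomTable M) (J : ℕ) (hJ : 0 < J)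
    (lo hi : ℤ × ℤ) (hbox : boxLicence K.frame lo hi = true) (hcov : coverM S K (K.gramR.map genBasis) hm = true)
    (hfacts : OutFactsSB K (fun i => shareRFastM S K (K.gramR.map genBasis) hm J i) lo hi 0 J) :
    ((symValueR K : ℚ) : ℝ) ≤ energyDensityTT' 1 0 8 (7 / 8) :=
  energyDensity_ge_of_outrouteSB K hwf hRok (momKey S hm) J hJ _ (fun i _ => shareRFastM_perm S K hm J i hcov) lo hi hbox
    hfacts

end Summit.Ventures.CertifiedManyBodySolver.Theorems.SymReplay
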